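import Summits.BirchSwinnertonDyer.Rank1Residual.X11b.KummerTorsionDecomposition
import Summits.BirchSwinnertonDyer.Rank1Residual.X11b.KummerRelaxationIndexExact
import Summits.BirchSwinnertonDyer.Rank1Residual.X11b.BDPRouteSelmerCountLemmas
import Summits.BirchSwinnertonDyer.Rank1Residual.X11b.BDPRouteStrictAtPlace
import Summits.BirchSwinnertonDyer.BirchSwinnertonDyer.Theorems.PrintCf2SplitBadTwoLocalLineCount
import Summits.BirchSwinnertonDyer.BirchSwinnertonDyer.Theorems.PrintCf2SplitBadTwoLocalPointsScalarDyadic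
import Summits.BirchSwinnertonDyer.BirchSwinnertonDyer.Theorems.PrintCf2SplitBadTwoSelmerCountAtOnePlace
import HarnessLib

/-!
# Crux `PrintCf2.SplitBadTwoRankOneOfFacts` (stmt-BirchSwinnertonDyer-20368), road α v10.3, S3c input (F3) — THE RANK-ONE INPUT
# AT FINITE LEVEL: `loc_v Sel^{(p^k)}(E/K) = loc_v κ_{p^k}(E(K))` at every deep level, and the EXACT relaxation index
# `[H¹_{𝓚, ⊤ at v}(K, E[p^k]) : Sel^{(p^k)}(E/K)] = [E(K_v) : E(K) + p^k E(K_v)]`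

Cell `bsd-print-cf2`, EXTRA WIDTH seat `bsd-line-cf2-p1-w8` g3 (prover-bsd-line-cf2-p1-w8-g3-0); `--supports stmt-BirchSwinnertonDyer-20368`
(helper, Theses-free). HONEST FRAMING: nothing here closes the crux or a registered stub; BSD is not proved by any of this; no summit
statement is proved by this seat. No definition, no named fact, no `sorry`, no kit. beyond-print theorem: no.

WHY. The S3c residual (F3) of LEAD g12's cut 13 (`restrictedControl_two_of_ptFacts_factor_values`, hypothesis `hF3`:
«`v₂ #range(loc_v | 𝔖_{v̄}(K, W*)) = ℓ + e₃([d]₂)`») is, by Poitou–Tate, the statement that the image at the relaxed place `v`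
is the exact annihilator of the localised Mordell–Weil group (LEAD memo `F3-PT-ANALYSIS-g12.md` §§2–4). Its only GLOBAL input beyond
the duality itself is the RANK-ONE structure: at a deep finite level `p^k` the localisation of the TRUE Selmer group `Sel^{(p^k)}(E/K)`
at `v` is ALREADY the localisation of the Kummer classes of `E(K)` — the Tate–Shafarevich classes contribute nothing new at `v`.
LEAD §6 observed that at a fixed level the `Ш`-lifts do NOT die at `v`; the resolution is Milne's two-level diagram (ADT I §6 proof of
Prop. 6.9), ported by X11b route p2 (`KummerDecomp.selmerGroup_le_range_kummerMapTorsion_sup_map`,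
`KummerDecomp.res_mem_map_localKummerMap_of_mem_selmerGroup`): with `p^j` the exponent of `Ш(E/K)[p^∞]`, every class of
`Sel^{(p^k)}` localises into `κ_{p^k,v}(im E(K) + p^{k−j} E(K_v))`, and when `E(K_v)/torsion` is a `ℤ_p`-LINE on which `E(K)` has a point
of infinite order the `p^{k−j}`-multiples are absorbed: `p^c E(K_v) ⊆ ℤ·P + p^k E(K_v)` for a uniform `c` (§1). No global Euler
characteristic, no new named fact.

WHAT (all generic: `E = W` elliptic over a number field `K`; the frame instantiation is for the assembling seat):
* §1 `exists_pow_nsmul_eq_zsmul_add` — abstract: `G ⊇ U ≃+ ℤ_p` of finite index (Silverman VII.6.3 currency of -w7 g3 / -w2 g11),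
  `x₀ ∈ G` of infinite order ⟹ `∃ c, ∀ N y, ∃ M y', p^c • y = M • x₀ + p^N • y'`; `range_zsmul_le_of_line` — the subgroup form
  `(p^n •)(G) ≤ ℤx₀-image ⊔ (p^N •)(G)` for `n ≥ c`, and its specialisation `range_zsmul_le_baseChange_sup` to `G = E(K_v)`, `x₀ = P_v`.
* §2 **`map_localization_selmerGroup_eq_of_dense`** — for `d ∣ N = m·d` with `Ш(E/K) ∩ H¹(K,E)[N] ≤ H¹(K,E)[d]` and the density
  `(m •)(E(K_v)) ≤ im E(K) ⊔ (N •)(E(K_v))`: **`loc_v Sel^{(N)}(E/K) = loc_v κ_N(E(K))`** (as subgroups of `H¹(K_v, E[N])`);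
  `natCard_map_localization_selmerGroup_eq_of_dense` (the count).
* §3 **`relIndex_selmerGroup_kummerOutside_eq_index_of_dense`** — with X11b's EXACT relaxation index
  (`KummerPT.relIndex_selmerGroup_kummerOutside_mul_natCard_map_eq_of_facts`: `[KO_v : Sel] · #loc_v Sel = #E(K_v)[p^k] · #(𝓞_v/p^k)`,
  conditional on the named fact `poitouTate_selmerStructure_duality K`, Milne I.2.8 being the tree theorem
  `localEulerPoincareCharacteristic_adicCompletion_of_numberField`) and the Kummer index (`KummerIndex.relIndex_map_res_range_kummerMapTorsion`):
  **`[kummerOutside W (p^k) {v} : Sel^{(p^k)}(E/K)] = [E(K_v) : im E(K) + p^k E(K_v)]`** at every such level — the finite-level form of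
  «`#(Ш(E/K)^{v}[p^∞] / Ш(E/K)[p^∞]) = [E(K_v) ⊗ ℤ_p : closure of E(K)]`» (Cassels–Poitou–Tate), all infinite places of `K` complex.
* §4 `sha_inf_torsionBy_le_of_finite_primary` — the hypothesis on `Ш` from `Finite Ш(E/K)[p^∞]` (X11b `SelmerCount`), and
  `relIndex_selmerGroup_kummerOutside_eq_index_of_line` — §3 with both hypotheses discharged from «`Ш[p^∞]` finite» and
  «`E(K_v) ⊇ U ≃+ ℤ_p` of finite index, `P ∈ E(K)` of infinite order in `E(K_v)`», for all `k ≥ k₀`.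
USE for (F3) (S3c frame, `p = 2`, `v ∣ 2` split, `K = ℚ(√−7)`-type imaginary quadratic, `P` the generator): `E(K_v) ≅ E(ℚ₂) ⊇ ℤ₂` of finite
index (-w7 g3 `exists_finiteIndex_addEquiv_padicInt_of_finrank_eq_one`), so §4 applies; then `#range(loc_v|𝔖_{v̄}(K,W*)) = [KO_v : Sel]`
(e-part of the singular quotient at `v`; the e′-part vanishes since `W*(K_v) = W*(K)`) and the point index
`[E(K_v) : E(K) + 2^k E(K_v)] = 2^{dep(P)} · [W*′(K_v) : W*′(K)] = 2^ℓ` (-w2 g11 `LocalLineCount`, -w6 g3 depth p675150) give `e₃ ≡ 0`.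
presearch: «image of the relaxed Selmer group in the singular quotient = annihilator of the closure of the Mordell–Weil group» →
[corpus: MilneADT2006 I §6 Prop. 6.9, Lemma 6.15, Thm. 4.10] tree theorems (X11b `KummerPT`, `KummerDecomp`); [JetchevSkinnerWan2017
Prop. 3.2.1] idem; galaxy/corpus: no further source needed — no new fact.

References: [MilneADT2006] I Thm. 4.10, §6 Prop. 6.9, Lemma 6.15; [JetchevSkinnerWan2017] Prop. 3.2.1 (arXiv:1512.06894 pp. 10–11);
[SilvermanAEC2009] Prop. VII.6.3, Thm. X.4.2; [Howard2004HeegnerKolyvagin] Thm. 2.1.11.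
-/

noncomputable section

open scoped Classical

set_option linter.dupNamespace false
set_option autoImplicit false

open Function NumberField IsDedekindDomain WeierstrassCurve
open Literature.NumberTheory.EllipticCurves
open Literature.NumberTheory.GaloisRepresentations
open Literature.NumberTheory.GaloisCohomology
open Summit.BirchSwinnertonDyer.Rank1Residual.X11b
open Summit.BirchSwinnertonDyer.BirchSwinnertonDyer.Theorems.PrintCf2.LocalLineCount
open Literature.NumberTheory.GaloisRepresentations (LocalField.adicCompletionPadicAlgebra)

namespace Summit.BirchSwinnertonDyer.BirchSwinnertonDyer.Theorems.PrintCf2.SelmerLocImage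

/-! ## §1. Density of a line: `p^c G ⊆ ℤ x₀ + p^N G` uniformly in `N` -/

section Line

variable {G : Type*} [AddCommGroup G] {p : ℕ} [hp : Fact p.Prime]

/-- **Uniform density of the multiples of a point of infinite order.** If `G ⊇ U ≃+ ℤ_p` has finite index (so `G/G_tors ≅ ℤ_p`,
-w2 g11 `exists_surjective_coord`) and `x₀ ∈ G` has infinite order, there is ONE exponent `c` such that for EVERY `N` and every
`y ∈ G`: `p^c • y = M • x₀ + p^N • y'` for some integer `M` and some `y' ∈ G`. (`c = D + 2a` where `p^D ∥ ξ(x₀)` and `p^a·b`,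
`p ∤ b`, kills the torsion.) [folklore] [cite: SilvermanAEC2009, Prop. VII.6.3] -/
theorem exists_pow_nsmul_eq_zsmul_add (U : AddSubgroup G) [U.FiniteIndex] (e : U ≃+ ℤ_[p]) {x₀ : G}
    (hx₀ : ¬ IsOfFinAddOrder x₀) :
    ∃ c : ℕ, ∀ (N : ℕ) (y : G), ∃ (M : ℤ) (y' : G), p ^ c • y = M • x₀ + p ^ N • y' := by
  obtain ⟨ξ, hsurj, hker⟩ := exists_surjective_coord U e
  obtain ⟨a, b, hb, htors⟩ := exists_torsion_annihilator U e
  have hξ0 : ξ x₀ ≠ 0 := fun h ↦ hx₀ ((hker x₀).mp h)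
  -- `ξ x₀ = p^D * u`, `u` a unit
  set D : ℕ := (ξ x₀).valuation with hD
  set u : ℤ_[p]ˣ := PadicInt.unitCoeff hξ0 with hu
  have hx₀u : ξ x₀ = (u : ℤ_[p]) * (p : ℤ_[p]) ^ D := PadicInt.unitCoeff_spec hξ0
  refine ⟨D + 2 * a, fun N y ↦ ?_⟩
  -- choose `M₀ ≡ p^a ξ(y) u⁻¹ (mod p^{N+a})`
  set s : ℤ_[p] := (p : ℤ_[p]) ^ a * ξ y * (u⁻¹ : ℤ_[p]ˣ) with hs
  obtain ⟨t, ht⟩ := Ideal.mem_span_singleton'.mp (PadicInt.appr_spec (N + a) s)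
  set M₀ : ℕ := s.appr (N + a) with hM₀
  -- `p^{N+a} ∣ ξ (p^{D+a} y - M₀ x₀)`
  have hdiv : (p : ℤ_[p]) ^ (N + a) ∣ ξ (p ^ (D + a) • y - (M₀ : ℤ) • x₀) := by
    refine ⟨t * (u : ℤ_[p]) * (p : ℤ_[p]) ^ D, ?_⟩
    rw [map_sub, map_nsmul, map_zsmul, nsmul_eq_mul, zsmul_eq_mul, Nat.cast_pow, Int.cast_natCast, hx₀u]
    have hsM : (s : ℤ_[p]) - (M₀ : ℤ_[p]) = t * (p : ℤ_[p]) ^ (N + a) := by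
      rw [hM₀]; linear_combination -ht
    have hsu : (p : ℤ_[p]) ^ a * ξ y = s * (u : ℤ_[p]) := by
      rw [hs, mul_assoc, mul_assoc, Units.inv_mul, mul_one]
    calc (p : ℤ_[p]) ^ (D + a) * ξ y - (M₀ : ℤ_[p]) * ((u : ℤ_[p]) * (p : ℤ_[p]) ^ D)
        = ((p : ℤ_[p]) ^ a * ξ y - (M₀ : ℤ_[p]) * (u : ℤ_[p])) * (p : ℤ_[p]) ^ D := by ring
      _ = ((s - (M₀ : ℤ_[p])) * (u : ℤ_[p])) * (p : ℤ_[p]) ^ D := by rw [hsu]; ring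
      _ = (p : ℤ_[p]) ^ (N + a) * (t * (u : ℤ_[p]) * (p : ℤ_[p]) ^ D) := by rw [hsM]; ring
  obtain ⟨z, τ, hτ, hzτ⟩ := (exists_add_torsion_iff_dvd hsurj hker _ (N + a)).mpr hdiv
  -- multiply by `p^a`: the torsion term becomes prime-to-`p` torsion, hence a `p^N`-th multiple
  have hbτ : b • (p ^ a • τ) = 0 := by
    rw [← mul_nsmul', mul_comm, htors τ hτ]
  obtain ⟨y₁, hy₁⟩ := exists_pow_nsmul_eq_of_nsmul_eq_zero hb N hbτ
  refine ⟨(p : ℤ) ^ a * (M₀ : ℤ), p ^ (2 * a) • z + y₁, ?_⟩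
  have h1 : p ^ (D + 2 * a) • y = p ^ a • (p ^ (D + a) • y) := by
    rw [← mul_nsmul', show p ^ a * p ^ (D + a) = p ^ (D + 2 * a) by ring]
  have h2 : p ^ (D + a) • y = (M₀ : ℤ) • x₀ + (p ^ (N + a) • z + τ) := by
    rw [hzτ]; abel
  have h3 : p ^ a • (p ^ (N + a) • z) = p ^ N • (p ^ (2 * a) • z) := by
    rw [← mul_nsmul', ← mul_nsmul', show p ^ a * p ^ (N + a) = p ^ N * p ^ (2 * a) by ring]
  have h4 : ((p : ℤ) ^ a * (M₀ : ℤ)) • x₀ = p ^ a • ((M₀ : ℤ) • x₀) := by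
    rw [← Nat.cast_pow, mul_zsmul, natCast_zsmul]
  rw [h1, h2, smul_add, smul_add, h3, h4, smul_add, hy₁]

omit hp in
/-- **Subgroup form of the density.** With `c` as in `exists_pow_nsmul_eq_zsmul_add`: for `n ≥ c` and every `N`,
`(p^n •)(G) ≤ ℤ x₀ ⊔ (p^N •)(G)`. [folklore] -/
theorem range_zsmul_le_zmultiples_sup {x₀ : G} {c : ℕ}
    (hc : ∀ (N : ℕ) (y : G), ∃ (M : ℤ) (y' : G), p ^ c • y = M • x₀ + p ^ N • y') {n : ℕ} (hn : c ≤ n) (N : ℕ) :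
    (zsmulAddGroupHom ((p : ℤ) ^ n) : G →+ G).range ≤
      AddSubgroup.zmultiples x₀ ⊔ (zsmulAddGroupHom ((p : ℤ) ^ N) : G →+ G).range := by
  rintro _ ⟨y, rfl⟩
  obtain ⟨M, y', hy'⟩ := hc N (p ^ (n - c) • y)
  have h : ((p : ℤ) ^ n) • y = M • x₀ + p ^ N • y' := by
    rw [← hy', ← mul_nsmul', ← pow_add, Nat.add_sub_cancel' hn, ← Nat.cast_pow, natCast_zsmul]
  rw [zsmulAddGroupHom_apply, h]
  exact AddSubgroup.add_mem_sup (AddSubgroup.mem_zmultiples_iff.mpr ⟨M, rfl⟩)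
    ⟨y', by rw [zsmulAddGroupHom_apply, ← Nat.cast_pow, natCast_zsmul]⟩

end Line

/-! ## §2. `loc_v Sel^{(N)}(E/K) = loc_v κ_N(E(K))` at a deep level -/

section Selmer

variable {K : Type} [Field K] [NumberField K] (W : WeierstrassCurve K) [W.IsElliptic]

/-- **THE RANK-ONE INPUT AT FINITE LEVEL (generic).** Let `d ∣ N = m·d` be nonzero integers such that every class of
`Ш(E/K) ∩ H¹(K, E)[N]` is killed by `d`, and let `v` be a place at which the `m`-multiples of local points are absorbed by the
rational points modulo `N`: `m·E(K_v) ⊆ im(E(K) → E(K_v)) + N·E(K_v)`. Then **the localisation at `v` of the `N`-Selmer group IS the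
localisation of the Kummer classes of `E(K)`**: `loc_v Sel^{(N)}(E/K) = loc_v κ_N(E(K))` in `H¹(K_v, E[N])`. Proof: Milne's two-level
diagram (X11b `KummerDecomp.res_mem_map_localKummerMap_of_mem_selmerGroup`: every Selmer class localises to the Kummer class of a point of
`im E(K) + m·E(K_v)`) and `N·E(K_v) = ker κ_{N,v}`. [cite: MilneADT2006, Ch. I §6, proof of Prop. 6.9 and Lemma 6.15]
[cite: JetchevSkinnerWan2017, Prop. 3.2.1 (proof, arXiv:1512.06894 pp. 10–11)] -/
theorem map_localization_selmerGroup_eq_of_dense {d N m : ℤ} (h : d ∣ N) (hd : d ≠ 0) (hN : N ≠ 0) (hm : N = m * d)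
    (hSha : W.sha ⊓ AddSubgroup.torsionBy W.galH1 N ≤ AddSubgroup.torsionBy W.galH1 d) (v : Place K)
    (hdense : (zsmulAddGroupHom m : (W.baseChange (Place.Completion v)).toAffine.Point →+ _).range ≤
      (Affine.Point.baseChange (W' := W) K (Place.Completion v)).range ⊔
        (zsmulAddGroupHom N : (W.baseChange (Place.Completion v)).toAffine.Point →+ _).range) :
    (W.selmerGroup N).map (galoisCohomology.localization (W.torsionGaloisModule N) v 1) =
      ((kummerMapTorsion W N (W.zsmul_geomPoints_surjective_holds hN)).range).map
        (galoisCohomology.localization (W.torsionGaloisModule N) v 1) := by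
  haveI : CharZero (Place.Completion v) := charZero_placeCompletion (K := K) v
  set F := Place.Completion v with hF
  change (W.selmerGroup N).map (galoisCohomology.res (W.torsionGaloisModule N) F 1) =
    ((kummerMapTorsion W N (W.zsmul_geomPoints_surjective_holds hN)).range).map
      (galoisCohomology.res (W.torsionGaloisModule N) F 1)
  apply le_antisymm
  · rintro _ ⟨s, hs, rfl⟩
    rw [KummerIndex.map_res_range_kummerMapTorsion W F hN]
    obtain ⟨Q, hQ, hQs⟩ := KummerDecomp.res_mem_map_localKummerMap_of_mem_selmerGroup W h hd hN hm hSha v hs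
    have hQ' : Q ∈ (Affine.Point.baseChange (W' := W) K F).range ⊔
        (zsmulAddGroupHom N : (W.baseChange F).toAffine.Point →+ _).range := (sup_le le_sup_left hdense) hQ
    obtain ⟨P, hP, R, hR, rfl⟩ := AddSubgroup.mem_sup.mp hQ'
    have hR0 : W.localKummerMap F hN R = 0 := by
      rw [← AddMonoidHom.mem_ker, W.ker_localKummerMap F hN]
      exact hR
    rw [← hQs, map_add, hR0, add_zero]
    exact ⟨P, hP, rfl⟩
  · refine AddSubgroup.map_mono ?_
    rintro _ ⟨P, rfl⟩
    exact StrictAtPlace.kummerMapTorsion_mem_selmerGroup W _ P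

/-- **The count**: under the same hypotheses `#loc_v Sel^{(N)}(E/K) = #loc_v κ_N(E(K))`. [cite: MilneADT2006, Ch. I §6, proof of Prop. 6.9] -/
theorem natCard_map_localization_selmerGroup_eq_of_dense {d N m : ℤ} (h : d ∣ N) (hd : d ≠ 0) (hN : N ≠ 0)
    (hm : N = m * d) (hSha : W.sha ⊓ AddSubgroup.torsionBy W.galH1 N ≤ AddSubgroup.torsionBy W.galH1 d) (v : Place K)
    (hdense : (zsmulAddGroupHom m : (W.baseChange (Place.Completion v)).toAffine.Point →+ _).range ≤
      (Affine.Point.baseChange (W' := W) K (Place.Completion v)).range ⊔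
        (zsmulAddGroupHom N : (W.baseChange (Place.Completion v)).toAffine.Point →+ _).range) :
    Nat.card ((W.selmerGroup N).map (galoisCohomology.localization (W.torsionGaloisModule N) v 1)) =
      Nat.card (((kummerMapTorsion W N (W.zsmul_geomPoints_surjective_holds hN)).range).map
        (galoisCohomology.localization (W.torsionGaloisModule N) v 1)) := by
  rw [map_localization_selmerGroup_eq_of_dense W h hd hN hm hSha v hdense]

/-! ## §3. The EXACT relaxation index `[KO_v : Sel] = [E(K_v) : E(K) + p^k E(K_v)]` -/

/-- **`#𝓛_v = [E(K_v) : im E(K) + N E(K_v)] · #loc_v κ_N(E(K))`**: the local Kummer condition counted through the Kummer index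
(X11b `KummerIndex.relIndex_map_res_range_kummerMapTorsion`). [cite: JetchevSkinnerWan2017, Prop. 3.2.1 (proof)]
[cite: SilvermanAEC2009, X.§4 diagram (**)] -/
theorem natCard_kummerSelmerStructure_inr_eq_index_mul {N : ℤ} (hN : N ≠ 0) (𝔮 : HeightOneSpectrum (𝓞 K)) :
    Nat.card (W.kummerSelmerStructure N (Sum.inr 𝔮)) =
      ((Affine.Point.baseChange (W' := W) K (𝔮.adicCompletion K)).range ⊔
          (zsmulAddGroupHom N : (W.baseChange (𝔮.adicCompletion K)).toAffine.Point →+ _).range).index *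
        Nat.card (((kummerMapTorsion W N (W.zsmul_geomPoints_surjective_holds hN)).range).map
          (galoisCohomology.localization (W.torsionGaloisModule N) (Sum.inr 𝔮) 1)) := by
  haveI : CharZero (𝔮.adicCompletion K) := charZero_placeCompletion (K := K) (Sum.inr 𝔮)
  have hle := KummerIndex.map_res_range_kummerMapTorsion_le W (𝔮.adicCompletion K) hN
    (W.zsmul_geomPoints_surjective_holds hN)
  have hidx := KummerIndex.relIndex_map_res_range_kummerMapTorsion W (𝔮.adicCompletion K) hN
    (W.zsmul_geomPoints_surjective_holds hN)
  change Nat.card (W.kummerLocalConditionAt N (𝔮.adicCompletion K)) =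
    _ * Nat.card (((kummerMapTorsion W N (W.zsmul_geomPoints_surjective_holds hN)).range).map
      (galoisCohomology.res (W.torsionGaloisModule N) (𝔮.adicCompletion K) 1))
  rw [← SelmerCount.card_mul_relIndex_of_le hle, mul_comm]
  exact congrArg₂ (· * ·) hidx rfl

/-- **THE EXACT RELAXATION INDEX at a finite place `𝔮` (generic number field with complex infinite places, any prime `p`, `k ≥ 1`).**
If `p^j` (`j ≤ k`) kills `Ш(E/K) ∩ H¹(K,E)[p^k]` and the `p^{k−j}`-multiples of `E(K_𝔮)` are absorbed (`p^{k−j} E(K_𝔮) ⊆ im E(K) + p^k E(K_𝔮)`),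
then, CONDITIONAL on the named fact `poitouTate_selmerStructure_duality K` (Howard 2.1.11 / Milne I 4.10(b); Milne I 2.8 is a tree theorem):
**`[H¹_{𝓚, ⊤ at 𝔮}(K, E[p^k]) : Sel^{(p^k)}(E/K)] = [E(K_𝔮) : im E(K) + p^k E(K_𝔮)]`** — X11b's EXACT index
`[KO_𝔮 : Sel] · #loc_𝔮 Sel = #𝓛_𝔮` (`KummerPT.relIndex_selmerGroup_kummerOutside_mul_natCard_map_eq_of_facts`), §2, and the Kummer index.
This is the finite-level «`#(Ш(E/K)^{𝔮}[p^∞] ⧸ Ш(E/K)[p^∞]) = [E(K_𝔮) ⊗ ℤ_p : closure of E(K)]`» of Cassels–Poitou–Tate.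
[cite: MilneADT2006, Ch. I, Thm. 4.10(b), Lemma 6.15, §6 Prop. 6.9] [cite: JetchevSkinnerWan2017, Prop. 3.2.1]
[cite: Howard2004HeegnerKolyvagin, Thm. 2.1.11 (arXiv:1202.6340 p. 6)] -/
theorem relIndex_selmerGroup_kummerOutside_eq_index_of_dense (p k : ℕ) [hp : Fact p.Prime]
    (hK : ∀ w : InfinitePlace K, w.IsComplex) (hk : 0 < k) (hPT : poitouTate_selmerStructure_duality K)
    (𝔮 : HeightOneSpectrum (𝓞 K)) {j : ℕ} (hjk : j ≤ k)
    (hSha : W.sha ⊓ AddSubgroup.torsionBy W.galH1 ((p ^ k : ℕ) : ℤ) ≤ AddSubgroup.torsionBy W.galH1 ((p ^ j : ℕ) : ℤ))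
    (hdense : (zsmulAddGroupHom ((p ^ (k - j) : ℕ) : ℤ) : (W.baseChange (𝔮.adicCompletion K)).toAffine.Point →+ _).range ≤
      (Affine.Point.baseChange (W' := W) K (𝔮.adicCompletion K)).range ⊔
        (zsmulAddGroupHom ((p ^ k : ℕ) : ℤ) : (W.baseChange (𝔮.adicCompletion K)).toAffine.Point →+ _).range) :
    (W.selmerGroup ((p ^ k : ℕ) : ℤ)).relIndex (kummerOutside W (p ^ k) {Sum.inr 𝔮}) =
      ((Affine.Point.baseChange (W' := W) K (𝔮.adicCompletion K)).range ⊔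
        (zsmulAddGroupHom ((p ^ k : ℕ) : ℤ) : (W.baseChange (𝔮.adicCompletion K)).toAffine.Point →+ _).range).index := by
  have hpk0 : ((p ^ k : ℕ) : ℤ) ≠ 0 := by exact_mod_cast pow_ne_zero k hp.out.ne_zero
  have hpj0 : ((p ^ j : ℕ) : ℤ) ≠ 0 := by exact_mod_cast pow_ne_zero j hp.out.ne_zero
  have hdvd : ((p ^ j : ℕ) : ℤ) ∣ ((p ^ k : ℕ) : ℤ) := by exact_mod_cast pow_dvd_pow p hjk
  have hm : ((p ^ k : ℕ) : ℤ) = ((p ^ (k - j) : ℕ) : ℤ) * ((p ^ j : ℕ) : ℤ) := by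
    rw [← Nat.cast_mul, ← pow_add, Nat.sub_add_cancel hjk]
  -- X11b's exact index: `[KO : Sel] · #loc Sel = #E(K_𝔮)[p^k] · #(𝓞_𝔮/p^k)`
  have hX := KummerPT.relIndex_selmerGroup_kummerOutside_mul_natCard_map_eq_of_facts W p k hK hk hPT
    (fun v ↦ RestrictedSelmerPair.localEulerPoincareCharacteristic_adicCompletion_of_numberField v) 𝔮
  rw [← W.natCard_kummerSelmerStructure_inr 𝔮 (pow_ne_zero k hp.out.ne_zero)] at hX
  rw [natCard_map_localization_selmerGroup_eq_of_dense W hdvd hpj0 hpk0 hm hSha (Sum.inr 𝔮) hdense,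
    natCard_kummerSelmerStructure_inr_eq_index_mul W hpk0 𝔮] at hX
  -- cancel the (positive) common factor `#loc_𝔮 κ(E(K))`
  haveI : CharZero (𝔮.adicCompletion K) := charZero_placeCompletion (K := K) (Sum.inr 𝔮)
  haveI hfinL : Finite (W.kummerLocalConditionAt ((p ^ k : ℕ) : ℤ) (𝔮.adicCompletion K)) :=
    W.finite_kummerSelmerStructure_inr 𝔮 (pow_ne_zero k hp.out.ne_zero)
  have hle := KummerIndex.map_res_range_kummerMapTorsion_le W (𝔮.adicCompletion K) hpk0
    (W.zsmul_geomPoints_surjective_holds hpk0)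
  haveI : Finite (((kummerMapTorsion W ((p ^ k : ℕ) : ℤ) (W.zsmul_geomPoints_surjective_holds hpk0)).range).map
      (galoisCohomology.localization (W.torsionGaloisModule ((p ^ k : ℕ) : ℤ)) (Sum.inr 𝔮) 1)) :=
    Finite.of_injective _ (AddSubgroup.inclusion_injective hle)
  exact Nat.eq_of_mul_eq_mul_right Nat.card_pos hX

/-! ## §4. Discharging the two hypotheses: `Ш[p^∞]` finite; `E(K_v) ⊇ ℤ_p` of finite index with a rational point of infinite order -/

omit [W.IsElliptic] in
/-- **`Ш[p^∞]` finite ⟹ a uniform level `j` killing `Ш ∩ H¹(K, E)[p^k]` for every `k`** (X11b `SelmerCount`).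
[cite: SilvermanAEC2009, Thm X.4.2] -/
theorem exists_sha_inf_torsionBy_le (p : ℕ) [Fact p.Prime] [Finite (AddCommGroup.primaryComponent W.sha p)] :
    ∃ j : ℕ, ∀ k : ℕ, W.sha ⊓ AddSubgroup.torsionBy W.galH1 ((p ^ k : ℕ) : ℤ) ≤
      AddSubgroup.torsionBy W.galH1 ((p ^ j : ℕ) : ℤ) := by
  obtain ⟨j, hj⟩ := SelmerCount.exists_natCard_primaryComponent_eq_pow_of_finite p (G := W.sha)
  exact ⟨j, fun k z hz ↦ AddSubgroup.torsionBy.nsmul_iff.mpr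
    (SelmerCount.pow_nsmul_eq_zero_of_mem_sha_inf_torsionBy' W p hj k hz)⟩

omit [NumberField K] [W.IsElliptic] in
/-- **Density at a place where `E(K_v) ⊇ U ≃+ ℤ_p` of finite index and `E(K)` has a point of infinite order**: there is `c` with
`p^n E(K_v) ⊆ im E(K) + p^N E(K_v)` for all `n ≥ c` and all `N` (§1 with `x₀ = P_v`). [cite: SilvermanAEC2009, Prop. VII.6.3] -/
theorem exists_range_zsmul_le_baseChange_sup (p : ℕ) [Fact p.Prime] (F : Type) [Field F] [Algebra K F]
    (U : AddSubgroup (W.baseChange F).toAffine.Point) [U.FiniteIndex] (e : U ≃+ ℤ_[p])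
    {P : W.toAffine.Point} (hP : ¬ IsOfFinAddOrder (Affine.Point.baseChange (W' := W) K F P)) :
    ∃ c : ℕ, ∀ n N : ℕ, c ≤ n →
      (zsmulAddGroupHom ((p ^ n : ℕ) : ℤ) : (W.baseChange F).toAffine.Point →+ _).range ≤
        (Affine.Point.baseChange (W' := W) K F).range ⊔
          (zsmulAddGroupHom ((p ^ N : ℕ) : ℤ) : (W.baseChange F).toAffine.Point →+ _).range := by
  obtain ⟨c, hc⟩ := exists_pow_nsmul_eq_zsmul_add U e hP
  refine ⟨c, fun n N hn ↦ ?_⟩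
  rw [Nat.cast_pow, Nat.cast_pow]
  refine (range_zsmul_le_zmultiples_sup hc hn N).trans (sup_le_sup_right ?_ _)
  exact (AddSubgroup.zmultiples_le_of_mem ⟨P, rfl⟩)

/-- **THE EXACT RELAXATION INDEX from «`Ш[p^∞]` finite» and the local `ℤ_p`-line.** `K` with complex infinite places, `p` prime, `𝔮` a finite
place with `E(K_𝔮) ⊇ U ≃+ ℤ_p` of finite index (e.g. `[K_𝔮 : ℚ_p] = 1`, Silverman VII.6.3), `P ∈ E(K)` of infinite order in `E(K_𝔮)`,
`Ш(E/K)[p^∞]` finite: there is `k₀` such that for all `k ≥ k₀`,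
**`[kummerOutside W (p^k) {𝔮} : Sel^{(p^k)}(E/K)] = [E(K_𝔮) : im E(K) + p^k E(K_𝔮)]`**, conditional on `poitouTate_selmerStructure_duality K`.
(On an S3c frame: `p = 2`, `𝔮 = v` split, `P` the generator; the right side is `2^{dep(P)} · [E(K_v)_tors[2^∞] : E(K)_tors-image] = 2^ℓ`.)
[cite: MilneADT2006, Ch. I, Thm. 4.10(b), §6 Prop. 6.9, Lemma 6.15] [cite: JetchevSkinnerWan2017, Prop. 3.2.1] -/
theorem exists_relIndex_selmerGroup_kummerOutside_eq_index (p : ℕ) [hp : Fact p.Prime]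
    (hK : ∀ w : InfinitePlace K, w.IsComplex) (hPT : poitouTate_selmerStructure_duality K)
    [Finite (AddCommGroup.primaryComponent W.sha p)] (𝔮 : HeightOneSpectrum (𝓞 K))
    (U : AddSubgroup (W.baseChange (𝔮.adicCompletion K)).toAffine.Point) [U.FiniteIndex] (e : U ≃+ ℤ_[p])
    {P : W.toAffine.Point} (hP : ¬ IsOfFinAddOrder (Affine.Point.baseChange (W' := W) K (𝔮.adicCompletion K) P)) :
    ∃ k₀ : ℕ, ∀ k : ℕ, k₀ ≤ k →
      (W.selmerGroup ((p ^ k : ℕ) : ℤ)).relIndex (kummerOutside W (p ^ k) {Sum.inr 𝔮}) =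
        ((Affine.Point.baseChange (W' := W) K (𝔮.adicCompletion K)).range ⊔
          (zsmulAddGroupHom ((p ^ k : ℕ) : ℤ) : (W.baseChange (𝔮.adicCompletion K)).toAffine.Point →+ _).range).index := by
  obtain ⟨j, hj⟩ := exists_sha_inf_torsionBy_le W p
  obtain ⟨c, hc⟩ := exists_range_zsmul_le_baseChange_sup W p (𝔮.adicCompletion K) U e hP
  refine ⟨j + c + 1, fun k hk ↦ ?_⟩
  have hjk : j ≤ k := by omega
  exact relIndex_selmerGroup_kummerOutside_eq_index_of_dense W p k hK (by omega) hPT 𝔮 hjk (hj k)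
    (hc (k - j) k (by omega))

/-! ## §5. The dyadic split place of a quadratic field (`K_v ≅ ℚ₂`): the S3c frame shape -/

/-- **THE EXACT RELAXATION INDEX at a degree-one dyadic place.** `K` quadratic with all infinite places complex and two places
`v ≠ v̄` above `2` (so `K_v ≅ ℚ₂` and `E(K_v) ⊇ ℤ₂` of finite index, Silverman VII.6.3 — -w7 g3 `exists_finiteIndex_addEquiv_padicInt_of_finrank_eq_one`),
`P ∈ E(K)` of infinite order, `Ш(E/K)[2^∞]` finite: there is `k₀` with
**`[kummerOutside W (2^k) {v} : Sel^{(2^k)}(E/K)] = [E(K_v) : im E(K) + 2^k E(K_v)]`** for all `k ≥ k₀`, conditional on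
`poitouTate_selmerStructure_duality K`. This is the shape consumed on an S3c frame of crux 20368 for (F3).
[cite: MilneADT2006, Ch. I, Thm. 4.10(b), §6 Prop. 6.9] [cite: SilvermanAEC2009, Prop. VII.6.3] [cite: NeukirchANT1999, Ch. II Prop. (8.5)] -/
theorem exists_relIndex_selmerGroup_kummerOutside_eq_index_two (hK2 : Module.finrank ℚ K = 2)
    {v vbar : HeightOneSpectrum (𝓞 K)} (hv : ((2 : ℕ) : 𝓞 K) ∈ v.asIdeal) (hvbar : ((2 : ℕ) : 𝓞 K) ∈ vbar.asIdeal)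
    (hne : vbar ≠ v) (hK : ∀ w : InfinitePlace K, w.IsComplex)
    (hPT : poitouTate_selmerStructure_duality K) [Finite (AddCommGroup.primaryComponent W.sha 2)]
    {P : W.toAffine.Point} (hP : ¬ IsOfFinAddOrder P) :
    ∃ k₀ : ℕ, ∀ k : ℕ, k₀ ≤ k →
      (W.selmerGroup ((2 ^ k : ℕ) : ℤ)).relIndex (kummerOutside W (2 ^ k) {Sum.inr v}) =
        ((Affine.Point.baseChange (W' := W) K (v.adicCompletion K)).range ⊔
          (zsmulAddGroupHom ((2 ^ k : ℕ) : ℤ) : (W.baseChange (v.adicCompletion K)).toAffine.Point →+ _).range).index := by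
  have hinj : Function.Injective (Affine.Point.baseChange (W' := W) K (v.adicCompletion K)) :=
    Affine.Point.map_injective (W' := W) (Algebra.ofId K (v.adicCompletion K))
  have hP' : ¬ IsOfFinAddOrder (Affine.Point.baseChange (W' := W) K (v.adicCompletion K) P) :=
    fun h ↦ hP (hinj.isOfFinAddOrder_iff.mp h)
  haveI : Fact (Nat.Prime 2) := ⟨Nat.prime_two⟩
  letI : Algebra ℚ_[2] (v.adicCompletion K) := LocalField.adicCompletionPadicAlgebra v 2 hv
  have h1 : Module.finrank ℚ_[2] (v.adicCompletion K) = 1 := by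
    rw [Literature.NumberTheory.NumberFields.finrank_adicCompletionPadicAlgebra_eq 2 v hv]
    exact LocalPointsScalar.ramificationIdx_mul_inertiaDeg_eq_one_of_ne hK2 hv hvbar hne
  haveI : FiniteDimensional ℚ_[2] (v.adicCompletion K) := Module.finite_of_finrank_pos (by rw [h1]; exact one_pos)
  obtain ⟨U, hU, ⟨eU⟩⟩ :=
    LocalPointsScalar.exists_finiteIndex_addEquiv_padicInt_of_finrank_eq_one 2 h1 (W.baseChange (v.adicCompletion K))
  haveI := hU
  exact exists_relIndex_selmerGroup_kummerOutside_eq_index W 2 hK hPT v U eU hP'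

end Selmer

end Summit.BirchSwinnertonDyer.BirchSwinnertonDyer.Theorems.PrintCf2.SelmerLocImage

end
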